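import Summits.CriticalPhenomena.SAWScalingLimit.Theses.SAWChargeContinuation
import Summits.CriticalPhenomena.SAWScalingLimit.Theorems.SAWRenewalTightnessTightIdentificationGlue

/-!
# `SAWChargeContinuation.AssemblyTarget` (stmt-CriticalPhenomena-4929) — proved

Route `SAWChargeContinuation` of `CriticalPhenomena/SAWScalingLimit`, support item

  `AssemblyTarget : RestrictionIdentification → AvoidanceOfLimit → Target → SAWScalingLimit`,

where `Target = SAWAvoidanceLaw ∧ EventualTight ∧ SubseqSimple` (the lets `hull`, `pb`, `carrier`
of the route file are inlined abbreviations, definitionally transparent).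

This is the soft "Prokhorov + identification + uniqueness" tail of the Lawler–Schramm–Werner
programme for the planar self-avoiding walk (LSW 2004, §3.4.2 and Prediction 1 of §4.1;
Billingsley 1999, Thm. 5.1 and its Corollary), and everything it consumes is PROVED in the tree:

* the critical SAW laws `SAW.law D.carrier δ (a δ) (b δ)` are probability measures for all small
  `δ > 0` and the curve observable is measurable, Prokhorov on the Polish space `CurveClass ℂ`,
  the subsequence principle along `𝓝[>] 0` and uniqueness of the chordal SLE_κ law
  (`IsSLECurve.map_eq_holds`) — packaged as
  `Summit.CriticalPhenomena.SAWScalingLimit.Theorems.saw_convergesInLawToSLE_of_isTightMeasureSet_image`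
  (file `SAWRenewalTightnessTightIdentificationGlue.lean`);
* no existence fact for SLE_{8/3} is needed: the SLE curve comes out of the identified limit law.

## Proof

Fix `(D; a, b)` with an endpoint approximation. `EventualTight` (second conjunct of `Target`)
gives `δ₀ > 0` with `{(P_δ).map curve : δ ∈ (0, δ₀]}` tight. By the glue theorem it remains to
identify every subsequential weak limit `μ` (a probability measure, limit along `s_n → 0⁺`) as a
chordal SLE_{8/3} law of `D`. `SubseqSimple` (third conjunct) puts `μ` on the chordal carrier of
`D`; `AvoidanceOfLimit` fed with `SAWAvoidanceLaw` (first conjunct) gives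
`μ {range ⊆ cl D'} = Φ'_A(0)^{5/8}` for every hull subdomain `D'` with restriction data
`(φ, Φ, d)`; `RestrictionIdentification` turns these two facts into `IsSLELaw (8/3) D μ`.

## References

* G. F. Lawler, O. Schramm, W. Werner, *On the scaling limit of planar self-avoiding walk*, Proc.
  Sympos. Pure Math. 72 (2004), §3.4.2 and §4.1, Prediction 1.
* G. F. Lawler, O. Schramm, W. Werner, *Conformal restriction: the chordal case*, J. Amer. Math.
  Soc. 16 (2003), §3 and Thm. 6.1.
* P. Billingsley, *Convergence of Probability Measures*, 2nd ed. (1999), Thm. 5.1 and Corollary.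
-/

noncomputable section

open MeasureTheory Filter Topology Set
open scoped NNReal ENNReal BoundedContinuousFunction
open Literature.Probability.RandomPlanarGeometry Literature.Probability.LatticeModels
open Summit.CriticalPhenomena.SAWScalingLimit.Theses.SAWChargeContinuation

namespace Summit.CriticalPhenomena.SAWScalingLimit.Theorems

/-- **Identification of subsequential limits** for route `SAWChargeContinuation`: under
`RestrictionIdentification`, `AvoidanceOfLimit` and the target `X = SAWAvoidanceLaw ∧ EventualTight
∧ SubseqSimple`, every probability measure `μ` on `CurveClass ℂ` which is the weak limit of the
critical SAW laws of `(D_δ; a_δ, b_δ)` along a mesh sequence `s_n → 0⁺` is a chordal SLE_{8/3} law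
of `D` (LSW 2003 §3: a restriction-type random simple chord is determined by its hull-avoidance
probabilities `Φ'_A(0)^{5/8}`). [cite: LawlerSchrammWerner2003Restriction, §3 and Thm. 6.1] -/
theorem chargeContinuation_isSLELaw_of_subseqLimit (hRI : RestrictionIdentification)
    (hAL : AvoidanceOfLimit) (hX : Target) {D : DobrushinDomain} {a b : ℝ → Site 2}
    (hab : SAW.IsEndpointApprox D a b) {s : ℕ → ℝ} (hs : Tendsto s atTop (𝓝[>] (0 : ℝ)))
    {μ : Measure (CurveClass ℂ)} (hμ : IsProbabilityMeasure μ)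
    (hlim : ∀ f : CurveClass ℂ →ᵇ ℝ, Tendsto
      (fun n => ∫ γ, f γ.curve ∂(SAW.law D.carrier (s n) (a (s n)) (b (s n)))) atTop
      (𝓝 (∫ x, f x ∂μ))) :
    IsSLELaw ((8 : ℝ≥0) / 3) D μ := by
  obtain ⟨hA0, -, hS⟩ := hX
  refine hRI D μ hμ (hS D a b hab s μ hs hμ hlim) ?_
  intro D' hD' φ hφ Φ d hΦ hd
  exact hAL hA0 D a b hab s μ hs hμ hlim D' hD' φ hφ Φ d hΦ hd

/-- **`SAWChargeContinuation.AssemblyTarget` (stmt-CriticalPhenomena-4929) holds**: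
`RestrictionIdentification → AvoidanceOfLimit → Target → SAWScalingLimit`. For every Dobrushin
domain and endpoint approximation, `EventualTight` (second conjunct of `Target`) and the tree's
glue `saw_convergesInLawToSLE_of_isTightMeasureSet_image` (laws eventually probability measures,
Prokhorov on the Polish space `CurveClass ℂ`, subsequence principle along `𝓝[>] 0`, uniqueness of
the SLE law) reduce convergence in law to SLE_{8/3} to the identification of subsequential limits,
which is `chargeContinuation_isSLELaw_of_subseqLimit`. LSW 2004 §3.4.2 / §4.1 Prediction 1
(programme); Billingsley 1999 Thm. 5.1 and Corollary. [cite: BillingsleyCPM1999, Thm. 5.1, Corollary] -/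
theorem chargeContinuation_assemblyTarget_proof :
    Summit.CriticalPhenomena.SAWScalingLimit.Theses.SAWChargeContinuation.AssemblyTarget := by
  unfold Summit.CriticalPhenomena.SAWScalingLimit.Theses.SAWChargeContinuation.AssemblyTarget
  intro hRI hAL hX D a b hab
  obtain ⟨δ₀, hδ₀, htight⟩ := hX.2.1 D a b hab
  refine saw_convergesInLawToSLE_of_isTightMeasureSet_image hab hδ₀ htight ?_
  rintro μ hμ ⟨s, hs, hlim⟩
  exact chargeContinuation_isSLELaw_of_subseqLimit hRI hAL hX hab hs hμ hlim

end Summit.CriticalPhenomena.SAWScalingLimit.Theorems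

end
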